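import Literature.AlgebraicGeometry.Frobenioids.IrreducibleMorphismsPreSteps
import Literature.AlgebraicGeometry.Frobenioids.EquivalencePreStepsFSMFF2008
import Literature.AlgebraicGeometry.Frobenioids.EquivalenceTransport
import Literature.AlgebraicGeometry.Frobenioids.EquivalenceTransportAnchors
import Literature.AlgebraicGeometry.Frobenioids.EquivalencePreStepsQuasiIsotropic
import Literature.AlgebraicGeometry.Frobenioids.EquivalencePreStepsFSMType
import Literature.AlgebraicGeometry.Frobenioids.EquivalenceFrobeniusQuasiIsotropic
import Literature.AlgebraicGeometry.Frobenioids.BaseCategoryTheoreticityProofs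
import Literature.AlgebraicGeometry.Frobenioids.EquivalenceThm34OfThm34ii
import Literature.AlgebraicGeometry.Frobenioids.CategoryTheoreticityFacts
import HarnessLib

/-!
# Frobenioids I, Theorem 3.4 (ii) AS PRINTED (2008 base hypothesis): assembly and the named facts
# `FrdI.Thm34ii`, `FrdI.Thm34iii`, `FrdI.Thm34iv`, `FrdI.Thm34v`

Mochizuki, *The geometry of Frobenioids I: the general theory*, Kyushu J. Math. **62** (2008)
293–400, Thm. 3.4 (ii), kurims p. 62, proof p. 63 [cite: MochizukiFrdI2008, Thm. 3.4 (ii) p.62]: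

> "(ii) Suppose that `C₁`, `C₂` are of quasi-isotropic type, and that `D₁`, `D₂` are of FSMFF-type.
> Then `Ψ` preserves pre-steps, co-angular pre-steps, and group-like objects."

with "FSMFF-type" in the PRINTED §0 (2008) sense (`IsOfFSMFFType`: (a) finite FSMI-factorisation of
non-invertible FSM-morphisms, (b) bounded length of FSMI-chains out of each object). State of the tree
before this file: the printed route (p. 63, "follows formally from Proposition 1.14, (ii), (iii)") fails
because the printed Prop. 1.14 (iii) is false (cell record PR-1, `IrreducibleMorphismsCounterexample.lean`);
the cell proved Thm. 3.4 (ii) over bases of FSM-type (seat abc-iut-L1-t13), over bases of FSMFF-type in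
the author's REVISED 2024 sense (seat abc-iut-L1-t11, `EquivalencePreStepsFSMFF2024.lean`), and for
Frobenioids of perfect type over printed bases (seat abc-iut-w4-d093, `EquivalencePreStepsPerfect.lean`);
the class "FSMFF-2008 ∖ FSMFF-2024" of bases is non-empty (`FSMFFType2008Broom.lean`), so the 2008
wording (`FrdI.Thm34ii`, cell GAP-LEDGER row G-L1d8-1) stayed open.

PROOF-ONLY file (seat abc-iut-L1-t11, "assembly + closers" half of the cell's proof arm for G-L1d8-1).
The CORE is seat abc-iut-L1-t13's `FrdI.isPreStep_map_of_isIrreducible_of_isOfFSMFFType`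
(`EquivalencePreStepsFSMFF2008.lean`): for Frobenioids of isotropic type and `D₂` of FSMFF-type (2008),
an equivalence maps IRREDUCIBLE pre-steps to pre-steps — proved NOT through Prop. 1.14 (iii) but by a
Frobenius-degree transport along pre-steps, a Frobenius-trivial object over the base point (Def. 1.3
(i)(a)(b)) and the divisor bookkeeping of the Frobenius-conjugate step chain, which would otherwise
produce FSMI-chains of unbounded length out of one object of `D₂` (condition (b), 2008). From the core
(and its corollary `FrdI.not_isPreStep_inverse_map_of_isIrreducibleHom_of_isOfFSMFFType`) this file runs
the assembly exactly as in the 2024 file, with `IsOfFSMFFType2024 ↦ IsOfFSMFFType`: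

* `FrdI.isPreStep_map_of_isOfFSMFFType` — isotropic type, `D₂` of FSMFF-type (2008): `Ψ` maps ALL
  pre-steps to pre-steps (Prop. 1.14 (ii) in `C₁` and `C₂`, `PreFrobenioid.isPreStep_iff_isFSM_and_isMidAdjoint`,
  transport of FSM-ness and mid-adjointness, and the core for the class "irreducible non-pre-steps");
  `…_iff_…` (both bases), `FrdI.isGroupLikeObj_map_of_isOfFSMFFType` (`D₁`), and the three clauses
  `FrdI.thm34ii_isotropic_of_isOfFSMFFType`;
* the quasi-isotropic reduction (printed p. 63, first sentence; seat abc-iut-L1-t13's reduction of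
  `EquivalencePreStepsQuasiIsotropic.lean` verbatim: `Ψ^istr` via `FrdI.isotropicObjects_inverseImage`,
  isotropic hulls, Prop. 1.7 (iv)): `FrdI.isPreStep_map_of_quasiIsotropic_of_isOfFSMFFType`,
  `FrdI.isCoAngularPreStep_map_…`, `FrdI.isGroupLikeObj_map_…`, and **`FrdI.thm34ii_of_isOfFSMFFType`**
  = Thm. 3.4 (ii) as printed, all three clauses;
* closers: `FrdI.thm34ii_ofFunctor` — the typed per-instance `PreFrobenioidData.Thm34ii` at `ofFunctor`
  for EVERY pair of Frobenioids and every `Ψ` (its own antecedents consumed, nothing else assumed);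
  **`FrdI.Thm34ii_holds : FrdI.Thm34ii`**, and via `FrdI.thm34iii_iv_v_of_thm34ii`
  (`EquivalenceThm34OfThm34ii.lean`, seat abc-iut-L1-t13) **`FrdI.Thm34iii_holds`, `FrdI.Thm34iv_holds`,
  `FrdI.Thm34v_holds`** — the 0-ary named facts [FrdI] Thm. 3.4 (ii), (iii), (iv), (v) in their 2008
  wording (cell FACT-LIST F-0711 – F-0714) are theorems.

No definition; no statement of the paper is restated or strengthened; nothing here bears on [IUTchIII].
-/

set_option backward.isDefEq.respectTransparency false

namespace Literature.AlgebraicGeometry.Frobenioids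

open CategoryTheory Opposite

universe w v v' u u'

namespace FrdI

section Isotropic

variable {D₁ : Type u} [Category.{v} D₁] {Φ₁ : D₁ᵒᵖ ⥤ CommMonCat.{w}} {C₁ : Type u'}
  [Category.{v'} C₁] {D₂ : Type u} [Category.{v} D₂] {Φ₂ : D₂ᵒᵖ ⥤ CommMonCat.{w}} {C₂ : Type u'}
  [Category.{v'} C₂] {F₁ : C₁ ⥤ ElemFrobenioid Φ₁} {F₂ : C₂ ⥤ ElemFrobenioid Φ₂}

/-- **Thm. 3.4 (ii), pre-steps — isotropic case, base `D₂` of FSMFF-type AS PRINTED (2008)**: an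
equivalence `Ψ : C₁ ⥲ C₂` of Frobenioids of isotropic type maps pre-steps to pre-steps. Route:
Prop. 1.14 (ii) in `C₁` and in `C₂` (condition (a) of `D₂`), transport of FSM-ness and mid-adjointness,
and the irreducible-pre-step core (seat abc-iut-L1-t13) in place of Prop. 1.14 (iii).
[cite: MochizukiFrdI2008, Thm. 3.4 (ii) p.63] -/
theorem isPreStep_map_of_isOfFSMFFType (hF₁ : PreFrobenioid.IsFrobenioid F₁)
    (hF₂ : PreFrobenioid.IsFrobenioid F₂) (hist₁ : PreFrobenioid.IsOfIsotropicType F₁)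
    (hist₂ : PreFrobenioid.IsOfIsotropicType F₂) (hD₂ : IsOfFSMFFType D₂) (Ψ : C₁ ≌ C₂)
    {A B : C₁} {φ : A ⟶ B} (hφ : PreFrobenioid.IsPreStep F₁ φ) :
    PreFrobenioid.IsPreStep F₂ (Ψ.functor.map φ) := by
  obtain ⟨hfsm, hmid⟩ := hφ.isFSM_and_isMidAdjoint F₁ hF₁ hist₁
  refine PreFrobenioid.isPreStep_of_isFSM_isMidAdjoint F₂ hF₂ hist₂ hD₂ (hfsm.map_equivalence Ψ) ?_
  refine IsMidAdjoint.map_equivalence Ψ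
    (S₁ := fun _ _ ψ => IsIrreducibleHom ψ ∧ ¬ PreFrobenioid.IsPreStep F₁ ψ)
    (S₂ := fun _ _ ψ => IsIrreducibleHom ψ ∧ ¬ PreFrobenioid.IsPreStep F₂ ψ) (fun X Y β hβ => ?_) hmid
  exact ⟨hβ.1.map_equivalence Ψ.symm, not_isPreStep_inverse_map_of_isIrreducibleHom_of_isOfFSMFFType
    hF₁ hF₂ hist₁ hist₂ hD₂ Ψ hβ.1 hβ.2⟩

/-- With both bases of FSMFF-type (2008) `Ψ` preserves AND reflects pre-steps.
[cite: MochizukiFrdI2008, Thm. 3.4 (ii) p.63] -/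
theorem isPreStep_map_iff_of_isOfFSMFFType (hF₁ : PreFrobenioid.IsFrobenioid F₁)
    (hF₂ : PreFrobenioid.IsFrobenioid F₂) (hist₁ : PreFrobenioid.IsOfIsotropicType F₁)
    (hist₂ : PreFrobenioid.IsOfIsotropicType F₂) (hD₁ : IsOfFSMFFType D₁) (hD₂ : IsOfFSMFFType D₂)
    (Ψ : C₁ ≌ C₂) {A B : C₁} (φ : A ⟶ B) :
    PreFrobenioid.IsPreStep F₂ (Ψ.functor.map φ) ↔ PreFrobenioid.IsPreStep F₁ φ := by
  refine ⟨fun h => ?_, isPreStep_map_of_isOfFSMFFType hF₁ hF₂ hist₁ hist₂ hD₂ Ψ⟩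
  have h1 := isPreStep_map_of_isOfFSMFFType hF₂ hF₁ hist₂ hist₁ hD₁ Ψ.symm h
  have h2 : PreFrobenioid.IsPreStep F₁ (Ψ.unitInv.app A ≫ φ ≫ Ψ.unit.app B) := by
    have := h1
    rw [show Ψ.symm.functor.map (Ψ.functor.map φ) = Ψ.inverse.map (Ψ.functor.map φ) from rfl,
      Ψ.inv_fun_map] at this
    exact this
  have h3 : PreFrobenioid.IsPreStep F₁ (φ ≫ Ψ.unit.app B) := by
    have h4 := PreFrobenioid.IsPreStep.comp F₁ (PreFrobenioid.isPreStep_of_isIso F₁ (Ψ.unit.app A)) h2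
    rwa [Iso.hom_inv_id_app_assoc] at h4
  have h5 := PreFrobenioid.IsPreStep.comp F₁ h3 (PreFrobenioid.isPreStep_of_isIso F₁ (Ψ.unitInv.app B))
  simpa using h5

/-- **`Ψ` preserves group-like objects** — isotropic type, base `D₁` of FSMFF-type (2008): the pre-step
clause for `Ψ⁻¹` and "group-like ⟺ every pre-step out of the object is invertible".
[cite: MochizukiFrdI2008, Thm. 3.4 (ii) p.62] -/
theorem isGroupLikeObj_map_of_isOfFSMFFType (hF₁ : PreFrobenioid.IsFrobenioid F₁)
    (hF₂ : PreFrobenioid.IsFrobenioid F₂) (hist₁ : PreFrobenioid.IsOfIsotropicType F₁)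
    (hist₂ : PreFrobenioid.IsOfIsotropicType F₂) (hD₁ : IsOfFSMFFType D₁) (Ψ : C₁ ≌ C₂) {A : C₁}
    (hA : PreFrobenioid.IsGroupLikeObj F₁ A) : PreFrobenioid.IsGroupLikeObj F₂ (Ψ.functor.obj A) := by
  rw [isGroupLikeObj_iff_preSteps_isIso hF₂ hist₂]
  intro B' φ' hφ'
  have hρ : PreFrobenioid.IsPreStep F₁ (Ψ.inverse.map φ') :=
    isPreStep_map_of_isOfFSMFFType hF₂ hF₁ hist₂ hist₁ hD₁ Ψ.symm hφ'
  have h1 : PreFrobenioid.IsPreStep F₁ (Ψ.unit.app A ≫ Ψ.inverse.map φ') :=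
    PreFrobenioid.IsPreStep.comp F₁ (PreFrobenioid.isPreStep_of_isIso F₁ _) hρ
  haveI : IsIso (Ψ.unit.app A ≫ Ψ.inverse.map φ') :=
    (isGroupLikeObj_iff_preSteps_isIso hF₁ hist₁ A).1 hA _ h1
  haveI : IsIso (Ψ.inverse.map φ') := IsIso.of_isIso_comp_left (Ψ.unit.app A) (Ψ.inverse.map φ')
  exact isIso_of_fully_faithful Ψ.inverse φ'

/-- **Thm. 3.4 (ii) for Frobenioids of ISOTROPIC type over bases of FSMFF-type AS PRINTED (2008)**:
`Ψ` preserves pre-steps, co-angular pre-steps and group-like objects.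
[cite: MochizukiFrdI2008, Thm. 3.4 (ii) p.62] -/
theorem thm34ii_isotropic_of_isOfFSMFFType (hF₁ : PreFrobenioid.IsFrobenioid F₁)
    (hF₂ : PreFrobenioid.IsFrobenioid F₂) (hist₁ : PreFrobenioid.IsOfIsotropicType F₁)
    (hist₂ : PreFrobenioid.IsOfIsotropicType F₂) (hD₁ : IsOfFSMFFType D₁) (hD₂ : IsOfFSMFFType D₂)
    (Ψ : C₁ ≌ C₂) :
    (∀ ⦃A B : C₁⦄ (φ : A ⟶ B), PreFrobenioid.IsPreStep F₁ φ → PreFrobenioid.IsPreStep F₂ (Ψ.functor.map φ)) ∧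
      (∀ ⦃A B : C₁⦄ (φ : A ⟶ B), PreFrobenioid.IsCoAngularPreStep F₁ φ →
        PreFrobenioid.IsCoAngularPreStep F₂ (Ψ.functor.map φ)) ∧
      (∀ ⦃A : C₁⦄, PreFrobenioid.IsGroupLikeObj F₁ A → PreFrobenioid.IsGroupLikeObj F₂ (Ψ.functor.obj A)) :=
  ⟨fun _ _ _ hφ => isPreStep_map_of_isOfFSMFFType hF₁ hF₂ hist₁ hist₂ hD₂ Ψ hφ,
    fun _ _ _ hφ => ⟨PreFrobenioid.isCoAngular_of_isIsotropic_codomains F₂ _ (fun Z _ => hist₂ Z),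
      isPreStep_map_of_isOfFSMFFType hF₁ hF₂ hist₁ hist₂ hD₂ Ψ hφ.2⟩,
    fun _ hA => isGroupLikeObj_map_of_isOfFSMFFType hF₁ hF₂ hist₁ hist₂ hD₁ Ψ hA⟩

end Isotropic

section QuasiIsotropic

variable {D₁ : Type u} [Category.{v} D₁] {Φ₁ : D₁ᵒᵖ ⥤ CommMonCat.{w}} {C₁ : Type u'}
  [Category.{v'} C₁] {D₂ : Type u} [Category.{v} D₂] {Φ₂ : D₂ᵒᵖ ⥤ CommMonCat.{w}} {C₂ : Type u'}
  [Category.{v'} C₂] {F₁ : C₁ ⥤ ElemFrobenioid Φ₁} {F₂ : C₂ ⥤ ElemFrobenioid Φ₂}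

/-- **Thm. 3.4 (ii), pre-steps — quasi-isotropic type, bases of FSMFF-type AS PRINTED (2008)**:
reduction to `Ψ^istr : C₁^istr ≌ C₂^istr` through isotropic hulls (printed p. 63; seat abc-iut-L1-t13's
reduction for FSM-type bases, verbatim) + the isotropic clause above.
[cite: MochizukiFrdI2008, Thm. 3.4 (ii) p.63] -/
theorem isPreStep_map_of_quasiIsotropic_of_isOfFSMFFType (hF₁ : PreFrobenioid.IsFrobenioid F₁)
    (hF₂ : PreFrobenioid.IsFrobenioid F₂)
    (hq₁ : (PreFrobenioidData.ofFunctor Φ₁ F₁).IsOfQuasiIsotropicType)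
    (hq₂ : (PreFrobenioidData.ofFunctor Φ₂ F₂).IsOfQuasiIsotropicType) (hD₂ : IsOfFSMFFType D₂)
    (Ψ : C₁ ≌ C₂) {A B : C₁} {φ : A ⟶ B} (hφ : PreFrobenioid.IsPreStep F₁ φ) :
    PreFrobenioid.IsPreStep F₂ (Ψ.functor.map φ) := by
  have hP₁ := hF₁.isPreFrobenioid
  have hP₂ := hF₂.isPreFrobenioid
  haveI : (PreFrobenioid.isotropicObjects F₂).IsClosedUnderIsomorphisms :=
    ⟨fun e hX => PreFrobenioid.IsIsotropic.of_iso hP₂ e.symm hX⟩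
  let Ψi : PreFrobenioid.Istr F₁ ≌ PreFrobenioid.Istr F₂ :=
    Ψ.congrFullSubcategory (isotropicObjects_inverseImage hF₁ hq₁ hq₂ Ψ)
  obtain ⟨A', hA, hhA⟩ := hF₁.vii_a A
  obtain ⟨B', hB, hhB⟩ := hF₁.vii_a B
  obtain ⟨-, hpA, hA'i, hunivA⟩ := id hhA
  obtain ⟨-, hpB, hB'i, -⟩ := id hhB
  obtain ⟨φ', hφ', -⟩ := hunivA (φ ≫ hB) hB'i
  have hφ'p : PreFrobenioid.IsPreStep F₁ φ' :=
    (PreFrobenioid.isPreStep_factors F₁ hP₁.isTotallyEpimorphic_base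
      (show PreFrobenioid.IsPreStep F₁ (hA ≫ φ') by
        rw [hφ']; exact PreFrobenioid.IsPreStep.comp F₁ hφ hpB)).1
  let a : PreFrobenioid.Istr F₁ := ⟨A', hA'i⟩
  let b : PreFrobenioid.Istr F₁ := ⟨B', hB'i⟩
  let f : a ⟶ b := ObjectProperty.homMk φ'
  have hf : PreFrobenioid.IsPreStep (PreFrobenioid.istrFunctor F₁) f := hφ'p
  have hcore := isPreStep_map_of_isOfFSMFFType (PreFrobenioid.isFrobenioid_istr hF₁)
    (PreFrobenioid.isFrobenioid_istr hF₂) (fun X => PreFrobenioid.isIsotropic_istr X)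
    (fun X => PreFrobenioid.isIsotropic_istr X) hD₂ Ψi hf
  have hΨφ' : PreFrobenioid.IsPreStep F₂ (Ψ.functor.map φ') := hcore
  obtain ⟨-, hΨhAp, -, -⟩ := isIsotropicHull_map hF₁ hF₂ hq₁ hq₂ Ψ hhA
  have hcomp : PreFrobenioid.IsPreStep F₂ (Ψ.functor.map φ ≫ Ψ.functor.map hB) := by
    rw [← Functor.map_comp, ← hφ', Functor.map_comp]
    exact PreFrobenioid.IsPreStep.comp F₂ hΨhAp hΨφ'
  exact (PreFrobenioid.isPreStep_factors F₂ hP₂.isTotallyEpimorphic_base hcomp).2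

/-- **Thm. 3.4 (ii), co-angular pre-steps — quasi-isotropic type, `D₂` of FSMFF-type (2008)**
(Prop. 1.7 (iv): a pre-step is co-angular iff mid-adjoint to the isometric pre-steps, which `Ψ⁻¹`
preserves by Thm. 3.4 (i)). [cite: MochizukiFrdI2008, Thm. 3.4 (ii) p.63] -/
theorem isCoAngularPreStep_map_of_quasiIsotropic_of_isOfFSMFFType
    (hF₁ : PreFrobenioid.IsFrobenioid F₁) (hF₂ : PreFrobenioid.IsFrobenioid F₂)
    (hq₁ : (PreFrobenioidData.ofFunctor Φ₁ F₁).IsOfQuasiIsotropicType)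
    (hq₂ : (PreFrobenioidData.ofFunctor Φ₂ F₂).IsOfQuasiIsotropicType) (hD₂ : IsOfFSMFFType D₂)
    (Ψ : C₁ ≌ C₂) {A B : C₁} {φ : A ⟶ B} (hφ : PreFrobenioid.IsCoAngularPreStep F₁ φ) :
    PreFrobenioid.IsCoAngularPreStep F₂ (Ψ.functor.map φ) := by
  have hp := isPreStep_map_of_quasiIsotropic_of_isOfFSMFFType hF₁ hF₂ hq₁ hq₂ hD₂ Ψ hφ.2
  refine ⟨?_, hp⟩
  rw [PreFrobenioid.isCoAngular_iff_isMidAdjoint_of_isPreStep F₂ hF₂ _ hp]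
  have h1 := (PreFrobenioid.isCoAngular_iff_isMidAdjoint_of_isPreStep F₁ hF₁ _ hφ.2).1 hφ.1
  refine h1.map_equivalence Ψ (fun X Y β hβ => ?_)
  obtain ⟨hi, hpre⟩ := isIsometry_isPreStep_map hF₂ hF₁ hq₂ hq₁ Ψ.symm hβ.1 hβ.2
  exact ⟨hi, hpre⟩

/-- **Thm. 3.4 (ii), group-like objects — quasi-isotropic type, `D₁` of FSMFF-type (2008)** (through
the isotropic hull, a base-isomorphism, and the isotropic clause on `C^istr`).
[cite: MochizukiFrdI2008, Thm. 3.4 (ii) p.63] -/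
theorem isGroupLikeObj_map_of_quasiIsotropic_of_isOfFSMFFType
    (hF₁ : PreFrobenioid.IsFrobenioid F₁) (hF₂ : PreFrobenioid.IsFrobenioid F₂)
    (hq₁ : (PreFrobenioidData.ofFunctor Φ₁ F₁).IsOfQuasiIsotropicType)
    (hq₂ : (PreFrobenioidData.ofFunctor Φ₂ F₂).IsOfQuasiIsotropicType) (hD₁ : IsOfFSMFFType D₁)
    (Ψ : C₁ ≌ C₂) {A : C₁} (hA : PreFrobenioid.IsGroupLikeObj F₁ A) :
    PreFrobenioid.IsGroupLikeObj F₂ (Ψ.functor.obj A) := by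
  have hP₁ := hF₁.isPreFrobenioid
  have hP₂ := hF₂.isPreFrobenioid
  haveI : (PreFrobenioid.isotropicObjects F₂).IsClosedUnderIsomorphisms :=
    ⟨fun e hX => PreFrobenioid.IsIsotropic.of_iso hP₂ e.symm hX⟩
  let Ψi : PreFrobenioid.Istr F₁ ≌ PreFrobenioid.Istr F₂ :=
    Ψ.congrFullSubcategory (isotropicObjects_inverseImage hF₁ hq₁ hq₂ Ψ)
  obtain ⟨A', h, hh⟩ := hF₁.vii_a A
  obtain ⟨-, hp, hA'i, -⟩ := id hh
  haveI : IsIso (PreFrobenioid.Base F₁ h) := hp.2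
  have hA' : PreFrobenioid.IsGroupLikeObj F₁ A' := fun x => by
    have := hA (pull Φ₁ (PreFrobenioid.Base F₁ h) x)
    exact (hP₁.isMonoidOn.isCharInjective (PreFrobenioid.Base F₁ h)).1 (this.trans (map_one _).symm)
  have hcore : PreFrobenioid.IsGroupLikeObj F₂ (Ψ.functor.obj A') :=
    isGroupLikeObj_map_of_isOfFSMFFType (PreFrobenioid.isFrobenioid_istr hF₁)
      (PreFrobenioid.isFrobenioid_istr hF₂) (fun X => PreFrobenioid.isIsotropic_istr X)
      (fun X => PreFrobenioid.isIsotropic_istr X) hD₁ Ψi (A := ⟨A', hA'i⟩) hA'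
  obtain ⟨-, hΨhp, -, -⟩ := isIsotropicHull_map hF₁ hF₂ hq₁ hq₂ Ψ hh
  haveI : IsIso (PreFrobenioid.Base F₂ (Ψ.functor.map h)) := hΨhp.2
  intro x
  have hx : x = pull Φ₂ (PreFrobenioid.Base F₂ (Ψ.functor.map h))
      (pull Φ₂ (inv (PreFrobenioid.Base F₂ (Ψ.functor.map h))) x) := by
    rw [← pull_comp, IsIso.hom_inv_id, pull_id]
  rw [hx, hcore (pull Φ₂ (inv (PreFrobenioid.Base F₂ (Ψ.functor.map h))) x), map_one]

/-- **[FrdI] Theorem 3.4 (ii) AS PRINTED (2008) — PROVED**: for Frobenioids `C₁`, `C₂` of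
quasi-isotropic type over base categories `D₁`, `D₂` of FSMFF-type (§0, 2008 wording) and an equivalence
`Ψ : C₁ ⥲ C₂`, "`Ψ` preserves pre-steps, co-angular pre-steps, and group-like objects."
[cite: MochizukiFrdI2008, Thm. 3.4 (ii) p.62] -/
theorem thm34ii_of_isOfFSMFFType (hF₁ : PreFrobenioid.IsFrobenioid F₁)
    (hF₂ : PreFrobenioid.IsFrobenioid F₂)
    (hq₁ : (PreFrobenioidData.ofFunctor Φ₁ F₁).IsOfQuasiIsotropicType)
    (hq₂ : (PreFrobenioidData.ofFunctor Φ₂ F₂).IsOfQuasiIsotropicType) (hD₁ : IsOfFSMFFType D₁)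
    (hD₂ : IsOfFSMFFType D₂) (Ψ : C₁ ≌ C₂) :
    PreFrobenioidData.PreservesMor Ψ.functor (PreFrobenioidData.ofFunctor Φ₁ F₁).IsPreStep
        (PreFrobenioidData.ofFunctor Φ₂ F₂).IsPreStep ∧
      PreFrobenioidData.PreservesMor Ψ.functor (PreFrobenioidData.ofFunctor Φ₁ F₁).IsCoAngularPreStep
        (PreFrobenioidData.ofFunctor Φ₂ F₂).IsCoAngularPreStep ∧
      PreFrobenioidData.PreservesObj Ψ.functor (PreFrobenioidData.ofFunctor Φ₁ F₁).IsGroupLikeObj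
        (PreFrobenioidData.ofFunctor Φ₂ F₂).IsGroupLikeObj := by
  refine ⟨fun A B φ hφ =>
      isPreStep_map_of_quasiIsotropic_of_isOfFSMFFType hF₁ hF₂ hq₁ hq₂ hD₂ Ψ hφ,
    fun A B φ hφ => ?_,
    fun A hA => isGroupLikeObj_map_of_quasiIsotropic_of_isOfFSMFFType hF₁ hF₂ hq₁ hq₂ hD₁ Ψ hA⟩
  have h := isCoAngularPreStep_map_of_quasiIsotropic_of_isOfFSMFFType hF₁ hF₂ hq₁ hq₂ hD₂ Ψ
    ⟨(PreFrobenioidData.ofFunctor_isCoAngular F₁ φ).1 hφ.1, hφ.2⟩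
  exact ⟨(PreFrobenioidData.ofFunctor_isCoAngular F₂ _).2 h.1, h.2⟩

/-- **The typed per-instance [FrdI] Thm. 3.4 (ii), `PreFrobenioidData.Thm34ii`, at `ofFunctor`, for EVERY
pair of Frobenioids and every equivalence `Ψ`** — its own antecedents (quasi-isotropic types, `D₁`, `D₂`
of FSMFF-type in the PRINTED 2008 sense) are consumed, nothing else is assumed.
[cite: MochizukiFrdI2008, Thm. 3.4 (ii) p.62] -/
theorem thm34ii_ofFunctor (hF₁ : PreFrobenioid.IsFrobenioid F₁) (hF₂ : PreFrobenioid.IsFrobenioid F₂)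
    (Ψ : C₁ ≌ C₂) : (PreFrobenioidData.ofFunctor Φ₁ F₁).Thm34ii (PreFrobenioidData.ofFunctor Φ₂ F₂) Ψ :=
  fun hq₁ hq₂ hD₁ hD₂ => thm34ii_of_isOfFSMFFType hF₁ hF₂ hq₁ hq₂ hD₁ hD₂ Ψ

end QuasiIsotropic

/-! ### The 0-ary named facts `FrdI.Thm34ii`, `Thm34iii`, `Thm34iv`, `Thm34v` (2008 wording) -/

/-- **The named fact [FrdI] Thm. 3.4 (ii) (2008 wording, `FrdI.Thm34ii`) HOLDS.**
[cite: MochizukiFrdI2008, Thm. 3.4 (ii) p.62] -/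
theorem Thm34ii_holds : Thm34ii.{w, v, v', u, u'} :=
  fun _ _ hF₁ hF₂ Ψ => thm34ii_ofFunctor hF₁ hF₂ Ψ

/-- **The named fact [FrdI] Thm. 3.4 (iii) (2008 wording) HOLDS** — from (ii) by
`thm34iii_iv_v_of_thm34ii` (seat abc-iut-L1-t13). [cite: MochizukiFrdI2008, Thm. 3.4 (iii) p.62] -/
theorem Thm34iii_holds : Thm34iii.{w, v, v', u, u'} :=
  (thm34iii_iv_v_of_thm34ii Thm34ii_holds).1

/-- **The named fact [FrdI] Thm. 3.4 (iv) (2008 wording) HOLDS.** [cite: MochizukiFrdI2008, Thm. 3.4 (iv) p.63] -/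
theorem Thm34iv_holds : Thm34iv.{w, v, v', u, u'} :=
  (thm34iii_iv_v_of_thm34ii Thm34ii_holds).2.1

/-- **The named fact [FrdI] Thm. 3.4 (v) (2008 wording) HOLDS.** [cite: MochizukiFrdI2008, Thm. 3.4 (v) p.63] -/
theorem Thm34v_holds : Thm34v.{w, v, v', u, u'} :=
  (thm34iii_iv_v_of_thm34ii Thm34ii_holds).2.2

end FrdI

end Literature.AlgebraicGeometry.Frobenioids
-- (enqueue re-land 2026-08-26T06:5xZ by abc-iut-w6-d040: tree bytes unchanged + this comment; the accepted p427329 had no olean after 60 min — ops/buildfix STRANDED-ACCEPT pattern)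
-- enqueue re-land #2 2026-08-26T08:47:21Z (abc-iut-L1-d6 g3): comment-only, declarations byte-identical to p427329/p429675; purpose = re-dispatch the stranded olean build (still «stale:99:unbuilt» at 08:38Z)
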